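import Mathlib
import Summits.Ventures.PercRepro2.ZMeanProof
import Summits.Ventures.PercRepro2.PendantRoot
import Summits.Ventures.PercRepro2.HMFLeaf
import Summits.Ventures.PercRepro2.HMFPendantRoot
import Summits.Ventures.PercRepro2.HMFTwoRootStar
import Summits.Ventures.PercRepro2.HMFTwoRootMass
import Summits.Ventures.PercRepro2.HMFTwoRootTransport

/-!
# (HMF) when `a₃` is adjacent only to the two roots (blind cell PercRepro2, night-1 g6;
exploration lens, NIGHT1-G6.md §7)

`a₃` carries exactly the edges `f₁ = {a₃, a₁}` (weight `α`) and `f₂ = {a₃, a₂}` (weight `β`), and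
`o, b ≠ a₃`, `a₁ ≠ a₂`.  Exploring `C(a₃)` never reveals a root edge beyond the star itself, and the
cleared mean-field functional of `ZMeanProof.lean` collapses to (`HMFc_two_root`)

  `HMFc = 2(1−α)(1−β)(1−αβ) · P(Q₀) · [ β(1−α) · Θ_h + α(1−β) · Θ_l ]`,

`Θ_h = P(Q₀,oL)(P(Q₀,bH) − P(Q₀,bL)) − P(Q₀) P(Q₀,oL,bH) + P(Q₀) E_h[1_Q g_o(C₂) g_b(C₂)]` (the
pendant-root bracket of the heavy cluster, `HMFPendantRoot.lean`) and `Θ_l` its mirror on the light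
cluster, where `Q₀`, `P(Q₀, ·)` are the star-free (both star edges closed) masses.  Each bracket is
`≥ 0` by same-cluster BHK in functional form (`bhk_same_heavy`) and cross-cluster BHK
(`bhk_cross_heavy`), hence **`HMF_two_root`**: (HMF) — the mean-field strengthening of (HCOV),
`HCov_of_HMF` — holds for every admissible weight vector on every such graph, an infinite class of
general graphs (arbitrary `G − a₃`).  At `α = 0` this is `HMF_pendant_root`.
-/

namespace Summit.Ventures.PercRepro2

open UnionCluster CovForm PendantRoot

namespace HMFTwoRoot

variable {V : Type*} {E : Type*} [Fintype E] [DecidableEq E] [Fintype V] [DecidableEq V]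
  {R : Type*} [Field R] [LinearOrder R] [IsStrictOrderedRing R]

/-! ## The identity and the theorem -/

section Theorem

variable (p : E → R) (ends : E → Sym2 V) {f₁ f₂ : E} {a₃ a₁ a₂ : V}

/-- **The mean-field identity at the two-root star** (NIGHT1-G6.md §7): with `α = p f₁`, `β = p f₂`,
`Z = P(Q₀)` and the star-free masses,
`HMFc = 2(1−α)(1−β)(1−αβ) Z · [β(1−α) Θ_h + α(1−β) Θ_l]`,
`Θ_h = P(Q₀,oL)(P(Q₀,bH) − P(Q₀,bL)) − Z P(Q₀,oL,bH) + Z E_h[1_Q g_o g_b]` (the pendant-root bracket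
of the heavy cluster) and `Θ_l` its mirror on the light cluster. -/
theorem HMFc_two_root (hp : IsProbVec p) (hf₁ : ends f₁ = s(a₃, a₁)) (hf₂ : ends f₂ = s(a₃, a₂))
    (hstar : ∀ e, a₃ ∈ ends e → e = f₁ ∨ e = f₂) (h31 : a₃ ≠ a₁) (h32 : a₃ ≠ a₂) (hroots : a₁ ≠ a₂)
    {o b : V} (ho : o ≠ a₃) (hb : b ≠ a₃) :
    HMFc p ends o a₁ a₂ a₃ b =
      2 * (1 - p f₁) * (1 - p f₂) * (1 - p f₁ * p f₂) * prob p (Q₀ ends f₁ f₂ a₁ a₂) *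
        (p f₂ * (1 - p f₁) *
            (prob p (Q₀ ends f₁ f₂ a₁ a₂ ∩ connEvent₀ ends f₁ f₂ a₁ o) *
                (prob p (Q₀ ends f₁ f₂ a₁ a₂ ∩ connEvent₀ ends f₁ f₂ a₂ b) -
                  prob p (Q₀ ends f₁ f₂ a₁ a₂ ∩ connEvent₀ ends f₁ f₂ a₁ b)) -
              prob p (Q₀ ends f₁ f₂ a₁ a₂) *
                prob p (Q₀ ends f₁ f₂ a₁ a₂ ∩
                  (connEvent₀ ends f₁ f₂ a₂ b ∩ connEvent₀ ends f₁ f₂ a₁ o)) +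
              prob p (Q₀ ends f₁ f₂ a₁ a₂) *
                HMFPendantRoot.Eprod (Function.update p f₁ 0) ends f₂ o a₁ a₂ b) +
          p f₁ * (1 - p f₂) *
            (prob p (Q₀ ends f₁ f₂ a₁ a₂ ∩ connEvent₀ ends f₁ f₂ a₂ o) *
                (prob p (Q₀ ends f₁ f₂ a₁ a₂ ∩ connEvent₀ ends f₁ f₂ a₁ b) -
                  prob p (Q₀ ends f₁ f₂ a₁ a₂ ∩ connEvent₀ ends f₁ f₂ a₂ b)) -
              prob p (Q₀ ends f₁ f₂ a₁ a₂) *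
                prob p (Q₀ ends f₁ f₂ a₁ a₂ ∩
                  (connEvent₀ ends f₁ f₂ a₁ b ∩ connEvent₀ ends f₁ f₂ a₂ o)) +
              prob p (Q₀ ends f₁ f₂ a₁ a₂) *
                HMFPendantRoot.Eprod (Function.update p f₂ 0) ends f₁ o a₂ a₁ b)) := by
  have h12 : f₁ ≠ f₂ := star_ne ends hf₁ hf₂ hroots
  have h13 : a₁ ≠ a₃ := Ne.symm h31
  have h23 : a₂ ≠ a₃ := Ne.symm h32
  have ht := termW_leaf_star p ends hp hf₁ hf₂ hstar h31 h32 ho hb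
  have hH := HMFPendantRoot.expect_Fheavy (Function.update p f₁ 0) ends (f := f₂) (a₂ := a₂) o a₁ b
  have hL := HMFPendantRoot.expect_Fheavy (Function.update p f₂ 0) ends (f := f₁) (a₂ := a₁) o a₂ b
  have hPh := transport_h p ends hf₁ hf₂ hstar h31 h32 h12
    (X := connEvent ends a₂ b ∩ connEvent ends a₁ o)
    (X₀ := connEvent₀ ends f₁ f₂ a₂ b ∩ connEvent₀ ends f₁ f₂ a₁ o)
    (fun _ hnb => mem_two_iff ends hf₁ hf₂ hstar h23 hb h13 ho hnb) (dependsOn_conn₀_inter ends a₂ b a₁ o)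
  have hPl := transport_l p ends hf₁ hf₂ hstar h31 h32 h12
    (X := connEvent ends a₁ b ∩ connEvent ends a₂ o)
    (X₀ := connEvent₀ ends f₁ f₂ a₁ b ∩ connEvent₀ ends f₁ f₂ a₂ o)
    (fun _ hnb => mem_two_iff ends hf₁ hf₂ hstar h13 hb h23 ho hnb) (dependsOn_conn₀_inter ends a₁ b a₂ o)
  unfold HMFc marginC DEF EQo EQ3 EQ3o Do massM2 deltaT
  rw [gap_eq_Q, Xhat_star p ends hf₁ hf₂ hstar h12 o b, heavy_sum_star p ends hf₁ hf₂ h12 o b,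
    light_sum_star p ends hf₁ hf₂ h12 o b, hH, hL, hPh, hPl,
    Set.inter_comm (connEvent ends a₂ b) (TEvent ends a₁ a₂ a₃),
    Set.inter_comm (connEvent ends a₁ b) (TEvent ends a₁ a₂ a₃)]
  simp only [prob_PD_star_X p ends hf₁ hf₂ hstar h31 h32 h12 h13 ho,
    prob_PD_star_X p ends hf₁ hf₂ hstar h31 h32 h12 h23 ho,
    prob_PD_star_X p ends hf₁ hf₂ hstar h31 h32 h12 h23 hb,
    prob_T_star_X p ends hf₁ hf₂ hstar h31 h32 h12 h13 ho,
    prob_T_star_X p ends hf₁ hf₂ hstar h31 h32 h12 h23 ho,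
    prob_T_star_X p ends hf₁ hf₂ hstar h31 h32 h12 h13 hb,
    prob_T_star_X p ends hf₁ hf₂ hstar h31 h32 h12 h23 hb,
    prob_T'_star_X p ends hf₁ hf₂ hstar h31 h32 h12 h13 ho,
    prob_T'_star_X p ends hf₁ hf₂ hstar h31 h32 h12 h23 ho,
    prob_Q_star_X p ends hf₁ hf₂ hstar h31 h32 h12 h13 ho,
    prob_Q_star_X p ends hf₁ hf₂ hstar h31 h32 h12 h23 ho,
    prob_Q_star_X p ends hf₁ hf₂ hstar h31 h32 h12 h13 hb,
    prob_Q_star_X p ends hf₁ hf₂ hstar h31 h32 h12 h23 hb,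
    prob_PD_star p ends hf₁ hf₂ hstar h31 h32 h12, prob_T_star p ends hf₁ hf₂ hstar h31 h32 h12,
    prob_T'_star p ends hf₁ hf₂ hstar h31 h32 h12, prob_Q_star p ends hf₁ hf₂ hstar h31 h32 h12]
  linear_combination (-2 * (1 - p f₁ * p f₂) * (1 - p f₁) ^ 2 * (1 - p f₂) ^ 2 *
    prob p (Q₀ ends f₁ f₂ a₁ a₂)) * ht

/-- **(HMF) when `a₃` is adjacent only to the two roots**: the mean-field form of (HCOV) (row 2′HMF)
holds for every admissible weight vector on every graph whose `a₃` carries exactly the edges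
`{a₃, a₁}` and `{a₃, a₂}` — the terminal class of an exploration of `C(a₃)` that never reveals a
root edge; the heavy and the light cluster each contribute a pendant-root bracket (`HMFc_two_root`),
each `≥ 0` by same-cluster BHK in functional form and cross-cluster BHK. -/
theorem HMF_two_root (hp : IsProbVec p) (hf₁ : ends f₁ = s(a₃, a₁)) (hf₂ : ends f₂ = s(a₃, a₂))
    (hstar : ∀ e, a₃ ∈ ends e → e = f₁ ∨ e = f₂) (h31 : a₃ ≠ a₁) (h32 : a₃ ≠ a₂) (hroots : a₁ ≠ a₂)
    {o b : V} (ho : o ≠ a₃) (hb : b ≠ a₃) : HMF p ends o a₁ a₂ a₃ b := by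
  unfold HMF
  rw [HMFc_two_root p ends hp hf₁ hf₂ hstar h31 h32 hroots ho hb]
  have h12 : f₁ ≠ f₂ := star_ne ends hf₁ hf₂ hroots
  have h13 : a₁ ≠ a₃ := Ne.symm h31
  have h23 : a₂ ≠ a₃ := Ne.symm h32
  have hp1 : IsProbVec (Function.update p f₁ 0) := hp.update f₁ le_rfl zero_le_one
  have hp2 : IsProbVec (Function.update p f₂ 0) := hp.update f₂ le_rfl zero_le_one
  -- the heavy cluster: same-cluster BHK (functional) and cross BHK, transported
  have hs := HMFPendantRoot.bhk_same_heavy (Function.update p f₁ 0) ends (f := f₂) (a₂ := a₂) hp1 o a₁ b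
  have hc := HMFPendantRoot.bhk_cross_heavy (Function.update p f₁ 0) ends (f := f₂) (a₂ := a₂) hp1 o a₁ b
  have t1 := transport_h p ends hf₁ hf₂ hstar h31 h32 h12 (X := connEvent ends a₁ o)
    (X₀ := connEvent₀ ends f₁ f₂ a₁ o) (fun _ hnb => mem_conn_iff_conn₀ ends hf₁ hf₂ hstar h13 ho hnb)
    (dependsOn_connEvent₀ a₁ o)
  have t2 := transport_h p ends hf₁ hf₂ hstar h31 h32 h12 (X := connEvent ends a₁ b)
    (X₀ := connEvent₀ ends f₁ f₂ a₁ b) (fun _ hnb => mem_conn_iff_conn₀ ends hf₁ hf₂ hstar h13 hb hnb)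
    (dependsOn_connEvent₀ a₁ b)
  have t3 := transport_h p ends hf₁ hf₂ hstar h31 h32 h12 (X := connEvent ends a₂ b)
    (X₀ := connEvent₀ ends f₁ f₂ a₂ b) (fun _ hnb => mem_conn_iff_conn₀ ends hf₁ hf₂ hstar h23 hb hnb)
    (dependsOn_connEvent₀ a₂ b)
  have t4 := transport_h p ends hf₁ hf₂ hstar h31 h32 h12
    (X := connEvent ends a₂ b ∩ connEvent ends a₁ o)
    (X₀ := connEvent₀ ends f₁ f₂ a₂ b ∩ connEvent₀ ends f₁ f₂ a₁ o)
    (fun _ hnb => mem_two_iff ends hf₁ hf₂ hstar h23 hb h13 ho hnb) (dependsOn_conn₀_inter ends a₂ b a₁ o)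
  have tQ := transport_h_Q p ends hf₁ hf₂ hstar h31 h32 h12
  rw [t1, t2, tQ] at hs
  rw [t4, tQ, t1, t3] at hc
  -- the light cluster: the mirror
  have hs' := HMFPendantRoot.bhk_same_heavy (Function.update p f₂ 0) ends (f := f₁) (a₂ := a₁) hp2 o a₂ b
  have hc' := HMFPendantRoot.bhk_cross_heavy (Function.update p f₂ 0) ends (f := f₁) (a₂ := a₁) hp2 o a₂ b
  have u1 := transport_l p ends hf₁ hf₂ hstar h31 h32 h12 (X := connEvent ends a₂ o)
    (X₀ := connEvent₀ ends f₁ f₂ a₂ o) (fun _ hnb => mem_conn_iff_conn₀ ends hf₁ hf₂ hstar h23 ho hnb)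
    (dependsOn_connEvent₀ a₂ o)
  have u2 := transport_l p ends hf₁ hf₂ hstar h31 h32 h12 (X := connEvent ends a₂ b)
    (X₀ := connEvent₀ ends f₁ f₂ a₂ b) (fun _ hnb => mem_conn_iff_conn₀ ends hf₁ hf₂ hstar h23 hb hnb)
    (dependsOn_connEvent₀ a₂ b)
  have u3 := transport_l p ends hf₁ hf₂ hstar h31 h32 h12 (X := connEvent ends a₁ b)
    (X₀ := connEvent₀ ends f₁ f₂ a₁ b) (fun _ hnb => mem_conn_iff_conn₀ ends hf₁ hf₂ hstar h13 hb hnb)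
    (dependsOn_connEvent₀ a₁ b)
  have u4 := transport_l p ends hf₁ hf₂ hstar h31 h32 h12
    (X := connEvent ends a₁ b ∩ connEvent ends a₂ o)
    (X₀ := connEvent₀ ends f₁ f₂ a₁ b ∩ connEvent₀ ends f₁ f₂ a₂ o)
    (fun _ hnb => mem_two_iff ends hf₁ hf₂ hstar h13 hb h23 ho hnb) (dependsOn_conn₀_inter ends a₁ b a₂ o)
  have uQ := transport_l_Q p ends hf₁ hf₂ hstar h31 h32 h12
  rw [u1, u2, uQ] at hs'
  rw [u4, uQ, u1, u3] at hc'
  -- signs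
  have hq1 := hp.nonneg f₁
  have hq1' := sub_nonneg.2 (hp.le_one f₁)
  have hq2 := hp.nonneg f₂
  have hq2' := sub_nonneg.2 (hp.le_one f₂)
  have hZ := prob_nonneg hp (Q₀ ends f₁ f₂ a₁ a₂)
  have hab : 0 ≤ 1 - p f₁ * p f₂ := by
    have := mul_le_mul (hp.le_one f₁) (hp.le_one f₂) hq2 zero_le_one
    linarith
  refine mul_nonneg (mul_nonneg (mul_nonneg (mul_nonneg (mul_nonneg (by norm_num) hq1') hq2') hab) hZ) ?_
  refine add_nonneg (mul_nonneg (mul_nonneg hq2 hq1') ?_) (mul_nonneg (mul_nonneg hq1 hq2') ?_)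
  · nlinarith [hs, hc]
  · nlinarith [hs', hc']

end Theorem

end HMFTwoRoot

end Summit.Ventures.PercRepro2
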